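import Literature.MathematicalPhysics.QuantumFieldTheory.Balaban1983to89.B6MultiLevelTorusOperator

/-!
# `Balaban1983to89.B4Eq242TorusMirrors` — [Balaban1983RegularityDecay] (2.42) p. 584, THE MULTIPLE REFLECTION METHOD, SIGNED AND FINITE — THE LATTICE SIDE:
# integer mirror hyperplanes on a doubled torus `Π_μ ℤ/N_μ` (`N_μ = 2n_μ`, mirrors `x_μ = h_μ` and `x_μ = h_μ + n_μ`), the face reflections as permutations of the
# fundamental box, their signs and index involutions, the open mirror box `X` with its freeness and mirror lemmas, the fold onto the closed box and its
# 1-Lipschitz property for the torus sup-distance, and the compatibility with every block grid whose side divides `2h_μ + 1` and `N_μ`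

statement-level skeleton of published theorems with citation tags; proofs where landed; nothing here is a claim about the Yang–Mills mass gap

CITATION HEADER (lean-in-tree rule).  [B4] = T. Bałaban, *Regularity and decay of lattice Green's functions*, Commun. Math. Phys. **89** (1983) 571–597
[`Balaban1983RegularityDecay`], p. 584 (journal page = PDF page + 570): «We represent G_j(□) with the help of the propagator G_j with free boundary conditions on
ξZ^d using the multiple reflection method. If □ is written as □ = {x ∈ ξZ^d : 0 ≤ x_μ ≤ M_μ, μ = 1,…,d}, then (2.42) G_j(□; x, x′) = G_j(x, x′) + Σ_{μ=1}^d
G_j(x, (x′_1,…,−x′_μ−ξ,…,x′_d)) + Σ_{μ=1}^d G_j(x, (x′_1,…,2M_μ−ξ−x′_μ,…,x′_d)) + …».  Here the reflections are through LATTICE hyperplanes (`x_μ ↦ 2h_μ − x_μ`: the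
sites ON the mirror are fixed and carry the Dirichlet value `0`), and they act on a FINITE doubled torus — the arithmetic behind [Balaban1985BackgroundPropagators]
p. 394 «the operator Δ′_a with Dirichlet boundary conditions on ∂Ω₀, i.e. the operator Δ′_a↾Ω₀ = Ω₀Δ′_aΩ₀»; [Balaban1984PropagatorsII] p. 224 (2.1)–(2.2) (big blocks,
torus distance) supplies the grids the reflections must respect.

WHY THIS FILE (cell `pub-ymgap`, YM Track A D-0062, DAG node N06 = [B9], seat `pub-ymgap-dag-n06-c` g31; ROAD (I) «IMAGES» of LOCATED-31, file D2a of D1–D3;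
node00-def-Y g38 CUSTODIAN ANSWERS Q1/Q2 YES, fleet INBOX 2026-08-31T11:47:00Z; lit-balaban lead g44 LINEAGE WORD «no objection», 11:48:53Z).  D1
`B4Eq242SignedImages` is the model-free identity `(A|_{X×X})⁻¹ = (Σ_i s_i G(·, σ_i ·))|_{X×X}` under four hypotheses (distinguished index, freeness, mirrors with index
involutions, no cross-coupling); D2 `B9CubeSequence408Reflected` builds r05's cube family reflected across the faces of a grid-symmetric mirror box.  THIS FILE is the
family-free lattice layer between them: everything about the reflections of a torus box that does not mention levels or operators.

WHAT IS PROVED (definitions with bodies: `mref`, `mfold`, `cdist` (one coordinate); `treflFun`, `tfoldFun`, `tsign`, `flipAt`, `single`, `mirIdx`, `mirBoxOpen`,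
`mirBoxClosed`, `trefl`, `tfold`, `vrefl` (the box); theorems; 0 sorry; 0 new named facts; standard axioms).
* §1 ONE COORDINATE (`N = 2n`, mirror `h`, `0 ≤ h < n`; sites `t ∈ [0, N)`): the reflection `mref n h t` (= `(2h − t) mod N`, `mref_eq_emod`) in closed form, an
  involution of `[0, N)` (`mref_mem`, `mref_mref`) whose fixed points are exactly the two mirror sites `h`, `h + n` (`mref_eq_self_iff`); the fold `mfold` onto the closed
  segment `[h, h + n]` (`mfold_mem`, `mfold_of_mem`, `mfold_of_not_mem`, `mfold_mref`); the circular distance `cdist` (= `circAbs N (t − t′)`, `circAbs_sub_eq_cdist`,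
  `cdist_comm`) is PRESERVED by `mref` and NOT INCREASED by `mfold` (`cdist_mref`, `cdist_mfold_le`, `n ≥ 2`); a site off the open segment at circular distance `≤ 1`
  from a site of it is a MIRROR site (`mref_eq_self_of_near`); freeness (`mref_not_mem_open`); GRIDS — for a block side `S = 2c + 1` with the mirror at a BLOCK CENTRE
  (`h = q₀S + c`, equivalently `S ∣ 2h + 1`: `two_mul_add_one_of_centre`) and `n = n_S·S`: the block indices of the mirrors (`ediv_mirror`, `ediv_mirror_add`), the two
  reflections reverse the block index (`ediv_sub_one_sub`, `ediv_reflect_lo/hi`), the branch test is a block property (`le_two_mul_iff_ediv`), hence `mref` and `mfold`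
  map `S`-blocks to `S`-blocks (`ediv_mref_eq_of_ediv_eq`, `ediv_mfold_eq_of_ediv_eq`) — print's tacit requirement that the reflections map blocks onto blocks.
* §2 THE BOX (`N : Fin (d+1) → ℕ`, mirrored directions `mir`, data `n h` there with the standing binder `hmir : mir μ → N_μ = 2n_μ ∧ 0 ≤ h_μ < n_μ ∧ 2 ≤ n_μ`):
  the face reflections `trefl hmir ε : Equiv.Perm ↥(boxDom N)` (`ε : Fin (d+1) → Bool`, acting in the directions `ε ∧ mir`; `treflFun_mem`, `treflFun_treflFun`,
  `trefl_apply_val`), `trefl_bot` (= 1), ★ `trefl_mul` (composition = pointwise `xor`: the group is `(ℤ/2)^{#mir}`), the signs `tsign R mir ε = (−1)^{#(ε ∧ mir)}`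
  (`tsign_bot`, `abs_tsign_le`) and the index involutions `flipAt μ` (`flipAt_eq_xor`, `trefl_flipAt : σ_{flip_μ ε} = σ_{δ_μ}·σ_ε`, `tsign_flipAt`, `flipAt_flipAt`,
  `flipAt_mem_mirIdx`, `bot_mem_mirIdx`), `trefl_single_ne_one`; the open / closed mirror boxes and ★ FREENESS (`trefl_not_mem_open`); ★ the MIRROR LEMMA
  (`exists_fixed_of_near`: a site off the open box within torus sup-distance `1` of a site of the box is fixed by a face reflection); the fold `tfold` (`tfoldFun_mem`,
  `tfold_apply_val`, `tfold_mem_closed`, `tfold_of_mem_closed`, `tfold_trefl`) and ★ its 1-LIPSCHITZ property (`torusSupNorm_tfold_sub_le`) next to the ISOMETRY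
  property of `trefl` (`torusSupNorm_trefl_sub`); ★ GRID COMPATIBILITY of `trefl` and `tfold` with every block side `S` whose mirrors are block centres with `S ∣ n_μ`
  (`blk_trefl_eq_of_blk_eq`, `blk_tfold_eq_of_blk_eq`); ★ REFLECTIONS CONJUGATE TRANSLATIONS (`vrefl`, `trefl_tshift : σ_ε ∘ τ_v = τ_{v^ε} ∘ σ_ε`) hence
  ★★ `perLapT_trefl` (the periodic Laplacian `B6MultiLevelTorusOperator.perLapT` is INVARIANT under every face reflection) and `torusSupNorm_tshift_self_sub_le` (torus
  neighbours are at distance `≤ 1`) — the inputs (b)–(d) of D1, the (2.1)/(2.2) inputs of D2 and the Laplacian half of the operator's mirror symmetry, family-free.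

PROOF.  Ours; one-coordinate case analysis (`omega` on the closed forms; `Int.add_mul_ediv_right` for the grids), assembled coordinatewise (`torusSupNorm` is the
`sup'` of the coordinates' `circAbs`).

HONEST SCOPE / NOT CLAIMED.  Lattice bookkeeping only: no operator, no level structure, no estimate; the mirrors are at INTEGER sites (Dirichlet sector), unlike
the half-integer mirrors of the Neumann engine `B4Reflection242` (not used, not modified).  Count-neutral; N06 NOT discharged; nothing on `d = 4`, the continuum,
reflection positivity, the mass gap or Clay.  No `sorry`, no `axiom`, no `instance`, no `notation`.  Seat `pub-ymgap-dag-n06-c` g31, 2026-08-31;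
`--supports stmt-QuantumFields-27239`.

RELATED IN THE TREE, NOT DUPLICATED (searched 2026-08-31, `rg` over `lean/Literature` + `lean/Summits` for `mref|trefl|tfold|mirBox|TorusMirrors`: 0 hits):
`B4Reflection242` §2 (`refl1`/`fold1`/`reflBox`: the half-integer (Neumann) reflection group of `ℤ^{d+1}` folding onto a box — other mirrors, infinite group),
`B6MultiLevelTorusOperator.tshift`/`twrap` (torus translations — used), `B4TorusKernel.circAbs`/`torusSupNorm` (the torus distance — used),
`B9CubeSequence408.window_of_blk_eq` (block invariance of aligned torus windows — same arithmetic species, other statement).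
-/

namespace Literature.MathematicalPhysics.QuantumFieldTheory.Balaban1983to89.B4Eq242TorusMirrors

noncomputable section

open Finset
open Literature.MathematicalPhysics.QuantumFieldTheory.Balaban1983to89.B4Reflection242 (boxDom mem_boxDom blk)
open Literature.MathematicalPhysics.QuantumFieldTheory.Balaban1983to89.B4TorusKernel.MultiPeriod (circAbs torusSupNorm circAbs_nonneg)
open Literature.MathematicalPhysics.QuantumFieldTheory.Balaban1983to89.B6MultiLevelTorusOperator (one_le_of_mem twrap tshift tshift_val tshift_val_eq_translate
  perLapT shiftMat unitVec)
open Literature.MathematicalPhysics.QuantumFieldTheory.Balaban1983to89.B4TorusKernel.MultiPeriod (translate translate_apply torusSupNorm_translate torusSupNorm_le_supNorm)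
open Literature.MathematicalPhysics.QuantumFieldTheory.Balaban1983to89.B4ContourShift (supNorm)

/-! ## §1  One coordinate: the doubled circle `ℤ/2n`, mirrors at `h` and `h + n` -/

section OneDim

/-- **THE LATTICE REFLECTION THROUGH THE MIRROR SITE `h` ON THE CIRCLE `ℤ/2n`**: `t ↦ (2h − t) mod 2n`, in closed form on `[0, 2n)`.
[cite: Balaban1983RegularityDecay, (2.42) p.584 (the reflections `x′_μ ↦ −x′_μ − ξ`, `x′_μ ↦ 2M_μ − ξ − x′_μ`; here through lattice sites)] -/
def mref (n h t : ℤ) : ℤ := if t ≤ 2 * h then 2 * h - t else 2 * h + 2 * n - t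

/-- **THE FOLD ONTO THE CLOSED SEGMENT `[h, h + n]`** (the fundamental domain of the two-mirror group on the circle): identity on the segment, the reflection off it.
[cite: Balaban1983RegularityDecay, (2.42) p.584, dictionary] -/
def mfold (n h t : ℤ) : ℤ := if t < h then 2 * h - t else if t ≤ h + n then t else 2 * h + 2 * n - t

/-- the circular distance of two sites of `[0, 2n)` in closed form: `min(|t − t′|, 2n − |t − t′|)`. [cite: Balaban1984PropagatorsII, (2.2) p.224 (torus distance), dictionary] -/
def cdist (n t t' : ℤ) : ℤ := min (max (t - t') (t' - t)) (2 * n - max (t - t') (t' - t))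

variable {n h t t' : ℤ}

/-- `mref` maps `[0, 2n)` to itself. [cite: Balaban1983RegularityDecay, (2.42) p.584, bookkeeping] -/
theorem mref_mem (h0 : 0 ≤ h) (hn : h < n) (ht : 0 ≤ t) (htN : t < 2 * n) : 0 ≤ mref n h t ∧ mref n h t < 2 * n := by
  unfold mref; split_ifs <;> omega

/-- `mref` is an involution of `[0, 2n)`. [cite: Balaban1983RegularityDecay, (2.42) p.584, bookkeeping] -/
theorem mref_mref (ht : 0 ≤ t) (htN : t < 2 * n) : mref n h (mref n h t) = t := by
  unfold mref; split_ifs <;> omega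

/-- ★ the fixed points of `mref` on `[0, 2n)` are exactly the two MIRROR SITES `h` and `h + n`. [cite: Balaban1983RegularityDecay, (2.42) p.584; Balaban1985BackgroundPropagators, p.394 (the Dirichlet boundary)] -/
theorem mref_eq_self_iff (h0 : 0 ≤ h) (hn : h < n) : mref n h t = t ↔ t = h ∨ t = h + n := by
  unfold mref; split_ifs <;> omega

/-- `mref` agrees with `(2h − t) mod 2n` on `[0, 2n)`. [cite: Balaban1983RegularityDecay, (2.42) p.584, dictionary] -/
theorem mref_eq_emod (h0 : 0 ≤ h) (hn : h < n) (ht : 0 ≤ t) (htN : t < 2 * n) : mref n h t = (2 * h - t) % (2 * n) := by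
  unfold mref
  split_ifs with hle
  · exact (Int.emod_eq_of_lt (by omega) (by omega)).symm
  · have e : (2 * h - t) % (2 * n) = (2 * h - t + 2 * n) % (2 * n) := by
      rw [Int.add_emod_right]
    rw [e, Int.emod_eq_of_lt (by omega) (by omega)]
    ring

/-- `mfold` lands in the closed segment `[h, h + n]`. [cite: Balaban1983RegularityDecay, (2.42) p.584, bookkeeping] -/
theorem mfold_mem (h0 : 0 ≤ h) (hn : h < n) (ht : 0 ≤ t) (htN : t < 2 * n) : h ≤ mfold n h t ∧ mfold n h t ≤ h + n := by
  unfold mfold; split_ifs <;> omega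

/-- `mfold` is the identity on the closed segment. [cite: Balaban1983RegularityDecay, (2.42) p.584, bookkeeping] -/
theorem mfold_of_mem (hlo : h ≤ t) (hhi : t ≤ h + n) : mfold n h t = t := by
  unfold mfold; split_ifs <;> omega

/-- off the closed segment `mfold` is the reflection. [cite: Balaban1983RegularityDecay, (2.42) p.584, bookkeeping] -/
theorem mfold_of_not_mem (h0 : 0 ≤ h) (htN : t < 2 * n) (hout : ¬ (h ≤ t ∧ t ≤ h + n)) :
    mfold n h t = mref n h t := by
  unfold mfold mref; split_ifs <;> omega

/-- `mfold` is invariant under the reflection. [cite: Balaban1983RegularityDecay, (2.42) p.584, bookkeeping] -/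
theorem mfold_mref (h0 : 0 ≤ h) (hn : h < n) (ht : 0 ≤ t) (htN : t < 2 * n) : mfold n h (mref n h t) = mfold n h t := by
  unfold mfold mref; split_ifs <;> omega

/-- ★ FREENESS in one coordinate: the reflection of a site of the OPEN segment `(h, h + n)` is not in the open segment.
[cite: Balaban1983RegularityDecay, (2.42) p.584 (distinct images)] -/
theorem mref_not_mem_open (hlo : h < t) (hhi : t < h + n) : ¬ (h < mref n h t ∧ mref n h t < h + n) := by
  unfold mref; split_ifs <;> omega

/-- `cdist` is the torus distance `circAbs (2n) (t − t′)` for sites of `[0, 2n)`. [cite: Balaban1984PropagatorsII, (2.2) p.224, dictionary] -/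
theorem circAbs_sub_eq_cdist {N : ℕ} (hN : (N : ℤ) = 2 * n) (ht : 0 ≤ t) (htN : t < 2 * n) (ht' : 0 ≤ t') (ht'N : t' < 2 * n) :
    circAbs N (t - t') = cdist n t t' := by
  unfold circAbs cdist
  rw [hN]
  have e : (t - t') % (2 * n) = if t' ≤ t then t - t' else t - t' + 2 * n := by
    split_ifs with hle
    · exact Int.emod_eq_of_lt (by omega) (by omega)
    · have e2 : (t - t') % (2 * n) = (t - t' + 2 * n) % (2 * n) := by rw [Int.add_emod_right]
      rw [e2]
      exact Int.emod_eq_of_lt (by omega) (by omega)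
  rw [e]
  split_ifs <;> omega

/-- ★ THE REFLECTION IS AN ISOMETRY of the circle. [cite: Balaban1983RegularityDecay, (2.42) p.584; Balaban1984PropagatorsII, (2.2) p.224] -/
theorem cdist_mref (h0 : 0 ≤ h) (hn : h < n) (ht : 0 ≤ t) (htN : t < 2 * n) (ht' : 0 ≤ t') (ht'N : t' < 2 * n) :
    cdist n (mref n h t) (mref n h t') = cdist n t t' := by
  unfold cdist mref; split_ifs <;> omega

/-- ★ THE FOLD DOES NOT INCREASE the circular distance (a path to an image is at least as long as the folded path).
[cite: Balaban1983RegularityDecay, (2.42) p.584; Balaban1984PropagatorsII, (2.2) p.224] -/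
theorem cdist_mfold_le (h0 : 0 ≤ h) (h2 : 2 ≤ n) (hn : h < n) (ht : 0 ≤ t) (htN : t < 2 * n) (ht' : 0 ≤ t') (ht'N : t' < 2 * n) :
    cdist n (mfold n h t) (mfold n h t') ≤ cdist n t t' := by
  unfold cdist mfold; split_ifs <;> omega

/-- `cdist` is symmetric. [cite: Balaban1984PropagatorsII, (2.2) p.224, bookkeeping] -/
theorem cdist_comm (t t' : ℤ) : cdist n t t' = cdist n t' t := by
  unfold cdist; rw [max_comm]

/-- ★ THE MIRROR LEMMA in one coordinate: a site `z` NOT in the open segment at circular distance `≤ 1` from a site `x` of the open segment is a mirror site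
(`mref z = z`). [cite: Balaban1985BackgroundPropagators, p.394 (Dirichlet boundary conditions on ∂Ω₀); Balaban1983RegularityDecay, (2.42) p.584] -/
theorem mref_eq_self_of_near (h0 : 0 ≤ h) (hn : h < n) {x z : ℤ} (hz0 : 0 ≤ z) (hzN : z < 2 * n)
    (hx : h < x ∧ x < h + n) (hz : ¬ (h < z ∧ z < h + n)) (hd : cdist n x z ≤ 1) : mref n h z = z := by
  unfold cdist at hd; unfold mref; split_ifs <;> omega

/-- the Euclidean quotient of `kS − 1 − t` by `S > 0`: `⌊(kS − 1 − t)/S⌋ = k − 1 − ⌊t/S⌋` (a reflection through a block boundary reverses the block index).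
[cite: Balaban1984PropagatorsII, (2.1) p.224 («a sum of big blocks»), bookkeeping] -/
theorem ediv_sub_one_sub {S : ℤ} (hS : 0 < S) (k t : ℤ) : (k * S - 1 - t) / S = k - 1 - t / S := by
  have hq := Int.emod_add_mul_ediv t S   -- t % S + S * (t / S) = t
  have hr0 := Int.emod_nonneg t hS.ne'
  have hr1 := Int.emod_lt_of_pos t hS
  have e : k * S - 1 - t = (S - 1 - t % S) + (k - 1 - t / S) * S := by linear_combination hq
  rw [e, Int.add_mul_ediv_right _ _ hS.ne', Int.ediv_eq_zero_of_lt (by omega) (by omega), zero_add]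

/-- BLOCK-CENTRE MIRRORS: the data of a mirror `h` at the CENTRE of an `S`-block (`S = 2c + 1` odd, `h = q₀S + c`) on a circle of `2n = 2n_S·S` sites — every block grid
whose side divides `2h + 1` and `n` is of this form. [cite: Balaban1984PropagatorsII, (2.1) p.224; Balaban1983RegularityDecay, (2.42) p.584, dictionary] -/
theorem two_mul_add_one_of_centre {S c q₀ : ℤ} (hSc : S = 2 * c + 1) (hh : h = q₀ * S + c) : 2 * h + 1 = (2 * q₀ + 1) * S := by
  rw [hh, hSc]; ring

variable {S c q₀ nS : ℤ}

/-- the block of the mirror site `h` is `q₀`. [cite: Balaban1984PropagatorsII, (2.1) p.224, bookkeeping] -/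
theorem ediv_mirror (hS : 0 < S) (hSc : S = 2 * c + 1) (hh : h = q₀ * S + c) : h / S = q₀ := by
  have hc : 0 ≤ c ∧ c < S := by omega
  rw [hh, show q₀ * S + c = c + q₀ * S by ring, Int.add_mul_ediv_right _ _ hS.ne', Int.ediv_eq_zero_of_lt hc.1 hc.2, zero_add]

/-- the block of the mirror site `h + n` is `q₀ + n_S`. [cite: Balaban1984PropagatorsII, (2.1) p.224, bookkeeping] -/
theorem ediv_mirror_add (hS : 0 < S) (hSc : S = 2 * c + 1) (hh : h = q₀ * S + c) (hnS : n = nS * S) : (h + n) / S = q₀ + nS := by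
  have hc : 0 ≤ c ∧ c < S := by omega
  rw [hh, hnS, show q₀ * S + c + nS * S = c + (q₀ + nS) * S by ring, Int.add_mul_ediv_right _ _ hS.ne',
    Int.ediv_eq_zero_of_lt hc.1 hc.2, zero_add]

/-- the first reflection reverses the block index about `q₀`: `⌊(2h − t)/S⌋ = 2q₀ − ⌊t/S⌋`. [cite: Balaban1983RegularityDecay, (2.42) p.584; Balaban1984PropagatorsII, (2.1) p.224] -/
theorem ediv_reflect_lo (hS : 0 < S) (hSc : S = 2 * c + 1) (hh : h = q₀ * S + c) (t : ℤ) : (2 * h - t) / S = 2 * q₀ - t / S := by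
  have e : 2 * h - t = (2 * q₀ + 1) * S - 1 - t := by rw [hh, hSc]; ring
  rw [e, ediv_sub_one_sub hS]; ring

/-- the second reflection reverses the block index about `q₀ + n_S`: `⌊(2h + 2n − t)/S⌋ = 2q₀ + 2n_S − ⌊t/S⌋`.
[cite: Balaban1983RegularityDecay, (2.42) p.584; Balaban1984PropagatorsII, (2.1) p.224] -/
theorem ediv_reflect_hi (hS : 0 < S) (hSc : S = 2 * c + 1) (hh : h = q₀ * S + c) (hnS : n = nS * S) (t : ℤ) :
    (2 * h + 2 * n - t) / S = 2 * q₀ + 2 * nS - t / S := by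
  have e : 2 * h + 2 * n - t = (2 * q₀ + 2 * nS + 1) * S - 1 - t := by rw [hh, hnS, hSc]; ring
  rw [e, ediv_sub_one_sub hS]; ring

/-- the branch test of `mref` is a block property: `t ≤ 2h ↔ ⌊t/S⌋ ≤ 2q₀`. [cite: Balaban1984PropagatorsII, (2.1) p.224, bookkeeping] -/
theorem le_two_mul_iff_ediv (hS : 0 < S) (hSc : S = 2 * c + 1) (hh : h = q₀ * S + c) (t : ℤ) : t ≤ 2 * h ↔ t / S ≤ 2 * q₀ := by
  have e : 2 * h = (2 * q₀ + 1) * S - 1 := by rw [hh, hSc]; ring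
  rw [e, ← Int.lt_add_one_iff (b := 2 * q₀), Int.ediv_lt_iff_lt_mul hS]
  constructor <;> intro h' <;> nlinarith

/-- ★ GRID COMPATIBILITY OF THE REFLECTION: for a block side `S` with the mirror at a block centre and `S ∣ n`, sites of one `S`-block reflect into one `S`-block
— print's tacit requirement that the reflections map blocks onto blocks. [cite: Balaban1984PropagatorsII, (2.1) p.224 («a sum of big blocks»); Balaban1983RegularityDecay, (2.42) p.584] -/
theorem ediv_mref_eq_of_ediv_eq (hS : 0 < S) (hSc : S = 2 * c + 1) (hh : h = q₀ * S + c) (hnS : n = nS * S)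
    (he : t / S = t' / S) : mref n h t / S = mref n h t' / S := by
  unfold mref
  by_cases hb : t ≤ 2 * h
  · have hb' : t' ≤ 2 * h := by rw [le_two_mul_iff_ediv hS hSc hh] at hb ⊢; rwa [← he]
    rw [if_pos hb, if_pos hb', ediv_reflect_lo hS hSc hh, ediv_reflect_lo hS hSc hh, he]
  · have hb' : ¬ t' ≤ 2 * h := by rw [le_two_mul_iff_ediv hS hSc hh] at hb ⊢; rwa [← he]
    rw [if_neg hb, if_neg hb', ediv_reflect_hi hS hSc hh hnS, ediv_reflect_hi hS hSc hh hnS, he]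

/-- ★ GRID COMPATIBILITY OF THE FOLD (same data, `n_S ≥ 1`): sites of one `S`-block fold into one `S`-block (the two mirror blocks fold into themselves).
[cite: Balaban1984PropagatorsII, (2.1) p.224; Balaban1983RegularityDecay, (2.42) p.584] -/
theorem ediv_mfold_eq_of_ediv_eq (hS : 0 < S) (hSc : S = 2 * c + 1) (hh : h = q₀ * S + c) (hnS : n = nS * S) (hnS1 : 1 ≤ nS)
    (he : t / S = t' / S) : mfold n h t / S = mfold n h t' / S := by
  have hq := Int.emod_add_mul_ediv t S
  have hq' := Int.emod_add_mul_ediv t' S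
  have hr0 := Int.emod_nonneg t hS.ne'
  have hr1 := Int.emod_lt_of_pos t hS
  have hr0' := Int.emod_nonneg t' hS.ne'
  have hr1' := Int.emod_lt_of_pos t' hS
  have hnS' : S ≤ n := by rw [hnS]; nlinarith
  -- the value of `mfold` in a block, as a function of the block index alone
  have val : ∀ u : ℤ, u / S = t / S →
      mfold n h u / S = if t / S < q₀ then 2 * q₀ - t / S else if t / S ≤ q₀ + nS then t / S else 2 * q₀ + 2 * nS - t / S := by
    intro u hu
    have hqu := Int.emod_add_mul_ediv u S
    have hru0 := Int.emod_nonneg u hS.ne'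
    have hru1 := Int.emod_lt_of_pos u hS
    -- `u` lies in `[S·(t/S), S·(t/S) + S)`
    have hu1 : S * (t / S) ≤ u := by rw [← hu]; omega
    have hu2 : u < S * (t / S) + S := by rw [← hu]; omega
    unfold mfold
    by_cases h1 : t / S < q₀
    · -- strictly left of the mirror block: `u < q₀S ≤ h`
      have hul : u < h := by rw [hh]; nlinarith
      rw [if_pos hul, if_pos h1, ediv_reflect_lo hS hSc hh, hu]
    · rw [if_neg h1]
      by_cases h2 : t / S ≤ q₀ + nS
      · rw [if_pos h2]
        by_cases hul : u < h
        · -- inside the lower mirror block (`t/S = q₀`), left of the centre: reflected into the same block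
          have hq0 : t / S = q₀ := by
            refine le_antisymm ?_ (not_lt.1 h1)
            by_contra hc
            have hc' : q₀ + 1 ≤ t / S := by omega
            rw [hh] at hul; nlinarith
          rw [if_pos hul, ediv_reflect_lo hS hSc hh, hu, hq0]; ring
        · rw [if_neg hul]
          by_cases hur : u ≤ h + n
          · rw [if_pos hur, hu]
          · -- inside the upper mirror block (`t/S = q₀ + n_S`), right of the centre: reflected into the same block
            have hq1 : t / S = q₀ + nS := by
              refine le_antisymm h2 ?_
              by_contra hc
              have hc' : t / S + 1 ≤ q₀ + nS := by omega
              rw [hh, hnS] at hur; nlinarith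
            rw [if_neg hur, ediv_reflect_hi hS hSc hh hnS, hu, hq1]; ring
      · -- strictly right of the upper mirror block: `u ≥ (q₀ + n_S + 1)S > h + n`
        rw [if_neg h2]
        have h2' : q₀ + nS + 1 ≤ t / S := by omega
        have hul : ¬ u < h := by rw [hh]; nlinarith
        have hur : ¬ u ≤ h + n := by rw [hh, hnS]; nlinarith
        rw [if_neg hul, if_neg hur, ediv_reflect_hi hS hSc hh hnS, hu]
  rw [val t rfl, val t' he.symm]

end OneDim


/-! ## §2  The box: face reflections of the doubled torus `Π_μ ℤ/N_μ` as permutations of the fundamental box -/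

section Box

variable {d : ℕ}

/-- the face reflections on lattice points: in each direction `μ` with `ε_μ ∧ mir_μ` apply the one-coordinate reflection through the mirror `h_μ` (period `2n_μ`),
elsewhere the identity. [cite: Balaban1983RegularityDecay, (2.42) p.584 («G_j(x, (x′_1,…,−x′_μ−ξ,…,x′_d))», the images coordinate by coordinate), dictionary] -/
def treflFun (mir : Fin (d + 1) → Bool) (n h : Fin (d + 1) → ℤ) (ε : Fin (d + 1) → Bool) (x : Fin (d + 1) → ℤ) : Fin (d + 1) → ℤ :=
  fun μ => if (ε μ && mir μ) = true then mref (n μ) (h μ) (x μ) else x μ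

/-- the fold on lattice points: fold every mirrored coordinate onto its closed segment `[h_μ, h_μ + n_μ]`. [cite: Balaban1983RegularityDecay, (2.42) p.584, dictionary] -/
def tfoldFun (mir : Fin (d + 1) → Bool) (n h : Fin (d + 1) → ℤ) (x : Fin (d + 1) → ℤ) : Fin (d + 1) → ℤ :=
  fun μ => if mir μ = true then mfold (n μ) (h μ) (x μ) else x μ

/-- the SIGN of a multi-index: `(−1)^{#{μ : ε_μ ∧ mir_μ}}` (odd images enter the Dirichlet image sum with a minus sign).
[cite: Balaban1983RegularityDecay, (2.42) p.584; Balaban1985BackgroundPropagators, p.394 (Dirichlet boundary conditions)] -/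
def tsign (R : Type*) [CommRing R] (mir ε : Fin (d + 1) → Bool) : R := ∏ μ, if (ε μ && mir μ) = true then (-1 : R) else 1

/-- flipping the `μ`-th entry of a multi-index (the index involution of the `μ`-th face reflection). [cite: Balaban1983RegularityDecay, (2.42) p.584, dictionary] -/
def flipAt (μ : Fin (d + 1)) (ε : Fin (d + 1) → Bool) : Fin (d + 1) → Bool := Function.update ε μ (!ε μ)

/-- the multi-index of the single face reflection in direction `μ`. [cite: Balaban1983RegularityDecay, (2.42) p.584, dictionary] -/
def single (μ : Fin (d + 1)) : Fin (d + 1) → Bool := Function.update (fun _ => false) μ true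

/-- the admissible multi-indices: supported in the mirrored directions. [cite: Balaban1983RegularityDecay, (2.42) p.584, dictionary] -/
def mirIdx (mir : Fin (d + 1) → Bool) : Finset (Fin (d + 1) → Bool) :=
  Finset.univ.filter fun ε => ∀ μ, ε μ = true → mir μ = true

variable (N : Fin (d + 1) → ℕ) (mir : Fin (d + 1) → Bool) (n h : Fin (d + 1) → ℤ)

/-- **THE OPEN MIRROR BOX `X`**: the sites strictly between the mirrors in every mirrored direction (all of the torus in the others) — the interior «Ω₀» carrying the
unknowns of the Dirichlet problem. [cite: Balaban1985BackgroundPropagators, p.394 («Δ′_a↾Ω₀ = Ω₀Δ′_aΩ₀»); Balaban1983RegularityDecay, (2.42) p.584] -/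
def mirBoxOpen : Finset ↥(boxDom N) :=
  Finset.univ.filter fun x => ∀ μ, mir μ = true → h μ < x.1 μ ∧ x.1 μ < h μ + n μ

/-- the CLOSED mirror box `X̄` (interior plus the mirror hyperplanes): the fundamental domain of the reflection group. [cite: Balaban1983RegularityDecay, (2.42) p.584, dictionary] -/
def mirBoxClosed : Finset ↥(boxDom N) :=
  Finset.univ.filter fun x => ∀ μ, mir μ = true → h μ ≤ x.1 μ ∧ x.1 μ ≤ h μ + n μ

variable {N mir n h}

/-- the face reflections map the fundamental box to itself (under the standing mirror data `hmir`: period `N_μ = 2n_μ`, mirror `0 ≤ h_μ < n_μ`, `n_μ ≥ 2` in every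
mirrored direction — kept as an explicit binder of every statement below). [cite: Balaban1983RegularityDecay, (2.42) p.584, bookkeeping] -/
theorem treflFun_mem (hmir : ∀ μ, mir μ = true → (N μ : ℤ) = 2 * n μ ∧ 0 ≤ h μ ∧ h μ < n μ ∧ 2 ≤ n μ)
    (ε : Fin (d + 1) → Bool) {x : Fin (d + 1) → ℤ} (hx : x ∈ boxDom N) : treflFun mir n h ε x ∈ boxDom N := by
  rw [mem_boxDom] at hx ⊢
  intro μ
  unfold treflFun
  by_cases hb : (ε μ && mir μ) = true
  · rw [if_pos hb]
    have hm : mir μ = true := by rw [Bool.and_eq_true] at hb; exact hb.2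
    obtain ⟨hNμ, h0, hn, -⟩ := hmir μ hm
    have := mref_mem h0 hn (hx μ).1 (by rw [← hNμ]; exact (hx μ).2)
    exact ⟨this.1, by rw [hNμ]; exact this.2⟩
  · rw [if_neg hb]; exact hx μ

/-- the face reflections are involutions on the box. [cite: Balaban1983RegularityDecay, (2.42) p.584, bookkeeping] -/
theorem treflFun_treflFun (hmir : ∀ μ, mir μ = true → (N μ : ℤ) = 2 * n μ ∧ 0 ≤ h μ ∧ h μ < n μ ∧ 2 ≤ n μ)
    (ε : Fin (d + 1) → Bool) {x : Fin (d + 1) → ℤ} (hx : x ∈ boxDom N) : treflFun mir n h ε (treflFun mir n h ε x) = x := by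
  rw [mem_boxDom] at hx
  funext μ
  unfold treflFun
  by_cases hb : (ε μ && mir μ) = true
  · rw [if_pos hb, if_pos hb]
    have hm : mir μ = true := by rw [Bool.and_eq_true] at hb; exact hb.2
    obtain ⟨hNμ, h0, hn, -⟩ := hmir μ hm
    exact mref_mref (hx μ).1 (by rw [← hNμ]; exact (hx μ).2)
  · rw [if_neg hb, if_neg hb]

/-- **THE FACE REFLECTION `σ_ε` AS A PERMUTATION OF THE FUNDAMENTAL BOX** of the doubled torus. [cite: Balaban1983RegularityDecay, (2.42) p.584] -/
def trefl (hmir : ∀ μ, mir μ = true → (N μ : ℤ) = 2 * n μ ∧ 0 ≤ h μ ∧ h μ < n μ ∧ 2 ≤ n μ) (ε : Fin (d + 1) → Bool) :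
    Equiv.Perm ↥(boxDom N) where
  toFun x := ⟨treflFun mir n h ε x.1, treflFun_mem hmir ε x.2⟩
  invFun x := ⟨treflFun mir n h ε x.1, treflFun_mem hmir ε x.2⟩
  left_inv x := Subtype.ext (treflFun_treflFun hmir ε x.2)
  right_inv x := Subtype.ext (treflFun_treflFun hmir ε x.2)

/-- the coordinates of a reflected site. [cite: Balaban1983RegularityDecay, (2.42) p.584, dictionary] -/
theorem trefl_apply_val (hmir : ∀ μ, mir μ = true → (N μ : ℤ) = 2 * n μ ∧ 0 ≤ h μ ∧ h μ < n μ ∧ 2 ≤ n μ) (ε : Fin (d + 1) → Bool)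
    (x : ↥(boxDom N)) (μ : Fin (d + 1)) :
    (trefl hmir ε x).1 μ = if (ε μ && mir μ) = true then mref (n μ) (h μ) (x.1 μ) else x.1 μ := rfl

/-- the trivial multi-index gives the identity. [cite: Balaban1983RegularityDecay, (2.42) p.584 (the term `G_j(x, x′)`), bookkeeping] -/
theorem trefl_bot (hmir : ∀ μ, mir μ = true → (N μ : ℤ) = 2 * n μ ∧ 0 ≤ h μ ∧ h μ < n μ ∧ 2 ≤ n μ) :
    trefl hmir (fun _ => false) = 1 := by
  ext x μ
  rw [trefl_apply_val]
  simp

/-- ★ the face reflections COMMUTE and compose by pointwise `xor` of the multi-indices (the reflection group is `(ℤ/2)^{#mir}`).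
[cite: Balaban1983RegularityDecay, (2.42) p.584 («+ …»: the group generated by the face reflections)] -/
theorem trefl_mul (hmir : ∀ μ, mir μ = true → (N μ : ℤ) = 2 * n μ ∧ 0 ≤ h μ ∧ h μ < n μ ∧ 2 ≤ n μ) (ε ε' : Fin (d + 1) → Bool) :
    trefl hmir ε * trefl hmir ε' = trefl hmir (fun μ => xor (ε μ) (ε' μ)) := by
  ext x μ
  rw [Equiv.Perm.mul_apply, trefl_apply_val, trefl_apply_val, trefl_apply_val]
  have hx := (mem_boxDom.1 x.2) μ
  by_cases hm : mir μ = true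
  · obtain ⟨hNμ, h0, hn, -⟩ := hmir μ hm
    have hxN : x.1 μ < 2 * n μ := by rw [← hNμ]; exact hx.2
    cases hε : ε μ <;> cases hε' : ε' μ <;> simp [hm, mref_mref hx.1 hxN]
  · have hm' : mir μ = false := by simpa using hm
    simp [hm']

/-- `flipAt μ ε` is `ε xor δ_μ`. [cite: Balaban1983RegularityDecay, (2.42) p.584, bookkeeping] -/
theorem flipAt_eq_xor (μ : Fin (d + 1)) (ε : Fin (d + 1) → Bool) : flipAt μ ε = fun ν => xor (single μ ν) (ε ν) := by
  funext ν
  unfold flipAt single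
  by_cases hν : ν = μ
  · subst hν; simp
  · simp [Function.update_of_ne hν]

/-- ★ flipping the `μ`-th index = composing with the `μ`-th face reflection: `σ_{flip_μ ε} = σ_{δ_μ} · σ_ε`. [cite: Balaban1983RegularityDecay, (2.42) p.584] -/
theorem trefl_flipAt (hmir : ∀ μ, mir μ = true → (N μ : ℤ) = 2 * n μ ∧ 0 ≤ h μ ∧ h μ < n μ ∧ 2 ≤ n μ) (μ : Fin (d + 1)) (ε : Fin (d + 1) → Bool) :
    trefl hmir (flipAt μ ε) = trefl hmir (single μ) * trefl hmir ε := by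
  rw [trefl_mul, flipAt_eq_xor]

/-- `flipAt μ` is an involution. [cite: Balaban1983RegularityDecay, (2.42) p.584, bookkeeping] -/
theorem flipAt_flipAt (μ : Fin (d + 1)) (ε : Fin (d + 1) → Bool) : flipAt μ (flipAt μ ε) = ε := by
  funext ν
  unfold flipAt
  by_cases hν : ν = μ
  · subst hν; simp
  · simp [Function.update_of_ne hν]

/-- `flipAt μ` preserves the admissible multi-indices when `μ` is mirrored. [cite: Balaban1983RegularityDecay, (2.42) p.584, bookkeeping] -/
theorem flipAt_mem_mirIdx {μ : Fin (d + 1)} (hμ : mir μ = true) {ε : Fin (d + 1) → Bool} (hε : ε ∈ mirIdx mir) :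
    flipAt μ ε ∈ mirIdx mir := by
  rw [mirIdx, Finset.mem_filter] at hε ⊢
  refine ⟨Finset.mem_univ _, fun ν hν => ?_⟩
  by_cases h' : ν = μ
  · subst h'; exact hμ
  · unfold flipAt at hν
    rw [Function.update_of_ne h'] at hν
    exact hε.2 ν hν

/-- the trivial multi-index is admissible. [cite: Balaban1983RegularityDecay, (2.42) p.584, bookkeeping] -/
theorem bot_mem_mirIdx : (fun _ => false : Fin (d + 1) → Bool) ∈ mirIdx mir := by
  rw [mirIdx, Finset.mem_filter]; exact ⟨Finset.mem_univ _, fun μ h => by simp at h⟩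

/-- ★ the sign flips under `flipAt μ` (`μ` mirrored): odd and even images alternate. [cite: Balaban1983RegularityDecay, (2.42) p.584; Balaban1985BackgroundPropagators, p.394] -/
theorem tsign_flipAt {R : Type*} [CommRing R] {μ : Fin (d + 1)} (hμ : mir μ = true) (ε : Fin (d + 1) → Bool) :
    tsign R mir (flipAt μ ε) = -tsign R mir ε := by
  unfold tsign
  rw [← Finset.mul_prod_erase Finset.univ _ (Finset.mem_univ μ), ← Finset.mul_prod_erase Finset.univ _ (Finset.mem_univ μ)]
  have hrest : ∏ ν ∈ Finset.univ.erase μ, (if (flipAt μ ε ν && mir ν) = true then (-1 : R) else 1) =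
      ∏ ν ∈ Finset.univ.erase μ, (if (ε ν && mir ν) = true then (-1 : R) else 1) := by
    refine Finset.prod_congr rfl fun ν hν => ?_
    rw [Finset.mem_erase] at hν
    unfold flipAt; rw [Function.update_of_ne hν.1]
  rw [hrest]
  unfold flipAt
  rw [Function.update_self]
  cases hε : ε μ <;> simp [hμ]

/-- the sign of the trivial multi-index is `1`. [cite: Balaban1983RegularityDecay, (2.42) p.584, bookkeeping] -/
theorem tsign_bot {R : Type*} [CommRing R] : tsign R mir (fun _ => false : Fin (d + 1) → Bool) = 1 := by
  unfold tsign; simp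

/-- the signs are `±1`: `|s_ε| ≤ 1` (the hypothesis of D1's decay fold). [cite: Balaban1983RegularityDecay, (2.42) p.584, bookkeeping] -/
theorem abs_tsign_le (ε : Fin (d + 1) → Bool) : |tsign ℝ mir ε| ≤ 1 := by
  unfold tsign
  rw [Finset.abs_prod]
  refine Finset.prod_le_one (fun _ _ => abs_nonneg _) fun μ _ => ?_
  split_ifs <;> simp

/-- ★ a single face reflection is NOT the identity (it moves the site `h_μ + 1` of the open box). [cite: Balaban1983RegularityDecay, (2.42) p.584, bookkeeping] -/
theorem trefl_single_ne_one (hN : ∀ μ, 1 ≤ N μ) (hmir : ∀ μ, mir μ = true → (N μ : ℤ) = 2 * n μ ∧ 0 ≤ h μ ∧ h μ < n μ ∧ 2 ≤ n μ)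
    {μ : Fin (d + 1)} (hμ : mir μ = true) : trefl hmir (single μ) ≠ 1 := by
  obtain ⟨hNμ, h0, hn, h2⟩ := hmir μ hμ
  -- the witness: `h_μ + 1` in direction `μ`, `0` elsewhere
  set w : Fin (d + 1) → ℤ := Function.update (fun _ => 0) μ (h μ + 1) with hw
  have hwmem : w ∈ boxDom N := by
    rw [mem_boxDom]; intro ν
    by_cases hν : ν = μ
    · subst hν; rw [hw, Function.update_self]; constructor <;> [omega; (rw [show (N ν : ℤ) = 2 * n ν from hNμ]; omega)]
    · rw [hw, Function.update_of_ne hν]; exact ⟨le_rfl, by exact_mod_cast hN ν⟩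
  intro hcontra
  have := congrArg (fun σ : Equiv.Perm ↥(boxDom N) => (σ ⟨w, hwmem⟩).1 μ) hcontra
  simp only [trefl_apply_val, Equiv.Perm.one_apply] at this
  rw [show (single μ μ && mir μ) = true by simp [single, hμ], if_pos rfl, hw, Function.update_self,
    mref_eq_self_iff h0 hn] at this
  omega

/-- ★ **FREENESS**: a non-trivially indexed image of a site of the open mirror box lies outside the open mirror box (hypothesis (c) of D1).
[cite: Balaban1983RegularityDecay, (2.42) p.584 (the images are distinct points outside □)] -/
theorem trefl_not_mem_open (hmir : ∀ μ, mir μ = true → (N μ : ℤ) = 2 * n μ ∧ 0 ≤ h μ ∧ h μ < n μ ∧ 2 ≤ n μ)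
    {ε : Fin (d + 1) → Bool} (hε : ε ∈ mirIdx mir) (hne : ε ≠ fun _ => false) {x : ↥(boxDom N)} (hx : x ∈ mirBoxOpen N mir n h) :
    trefl hmir ε x ∉ mirBoxOpen N mir n h := by
  obtain ⟨μ, hμ⟩ : ∃ μ, ε μ = true := by
    by_contra hc
    apply hne; funext ν
    cases h' : ε ν
    · rfl
    · exact absurd ⟨ν, h'⟩ hc
  have hm : mir μ = true := (Finset.mem_filter.1 hε).2 μ hμ
  obtain ⟨hNμ, h0, hn, -⟩ := hmir μ hm
  rw [mirBoxOpen, Finset.mem_filter] at hx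
  intro hc
  rw [mirBoxOpen, Finset.mem_filter] at hc
  have h1 := hc.2 μ hm
  rw [trefl_apply_val, show (ε μ && mir μ) = true by simp [hμ, hm], if_pos rfl] at h1
  exact mref_not_mem_open (hx.2 μ hm).1 (hx.2 μ hm).2 h1

/-- ★ **THE MIRROR LEMMA**: a site OUTSIDE the open mirror box within torus sup-distance `1` of a site INSIDE it is fixed by one of the face reflections (it lies on a
mirror hyperplane) — hypothesis (d) of D1 for any operator coupling only torus-nearest neighbours near the mirrors.
[cite: Balaban1985BackgroundPropagators, p.394 (Dirichlet boundary conditions on ∂Ω₀); Balaban1983RegularityDecay, (2.42) p.584] -/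
theorem exists_fixed_of_near (hmir : ∀ μ, mir μ = true → (N μ : ℤ) = 2 * n μ ∧ 0 ≤ h μ ∧ h μ < n μ ∧ 2 ≤ n μ)
    {x z : ↥(boxDom N)} (hx : x ∈ mirBoxOpen N mir n h) (hz : z ∉ mirBoxOpen N mir n h) (hd : torusSupNorm N (x.1 - z.1) ≤ 1) :
    ∃ μ, mir μ = true ∧ trefl hmir (single μ) z = z := by
  rw [mirBoxOpen, Finset.mem_filter] at hx hz
  have hz' : ¬ ∀ μ, mir μ = true → h μ < z.1 μ ∧ z.1 μ < h μ + n μ := fun hc => hz ⟨Finset.mem_univ _, hc⟩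
  obtain ⟨μ, hμ'⟩ := not_forall.1 hz'
  obtain ⟨hm, hzμ⟩ := Classical.not_imp.1 hμ'
  obtain ⟨hNμ, h0, hn, -⟩ := hmir μ hm
  have hxμ := (mem_boxDom.1 x.2) μ
  have hzb := (mem_boxDom.1 z.2) μ
  refine ⟨μ, hm, Subtype.ext (funext fun ν => ?_)⟩
  rw [trefl_apply_val]
  by_cases hν : ν = μ
  · subst hν
    rw [show (single ν ν && mir ν) = true by simp [single, hm], if_pos rfl]
    have hcd : cdist (n ν) (x.1 ν) (z.1 ν) ≤ 1 := by
      have h1 : ((circAbs (N ν) ((x.1 - z.1) ν) : ℤ) : ℝ) ≤ 1 :=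
        (Finset.le_sup' (fun i => ((circAbs (N i) ((x.1 - z.1) i) : ℤ) : ℝ)) (Finset.mem_univ ν)).trans hd
      rw [Pi.sub_apply, circAbs_sub_eq_cdist hNμ hxμ.1 (by rw [← hNμ]; exact hxμ.2) hzb.1 (by rw [← hNμ]; exact hzb.2)] at h1
      exact_mod_cast h1
    exact mref_eq_self_of_near h0 hn hzb.1 (by rw [← hNμ]; exact hzb.2) (hx.2 ν hm) hzμ hcd
  · rw [show (single μ ν && mir ν) = false by simp [single, Function.update_of_ne hν], if_neg (by simp)]

/-- the fold lands in the box. [cite: Balaban1983RegularityDecay, (2.42) p.584, bookkeeping] -/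
theorem tfoldFun_mem (hmir : ∀ μ, mir μ = true → (N μ : ℤ) = 2 * n μ ∧ 0 ≤ h μ ∧ h μ < n μ ∧ 2 ≤ n μ)
    {x : Fin (d + 1) → ℤ} (hx : x ∈ boxDom N) : tfoldFun mir n h x ∈ boxDom N := by
  rw [mem_boxDom] at hx ⊢
  intro μ
  unfold tfoldFun
  by_cases hm : mir μ = true
  · rw [if_pos hm]
    obtain ⟨hNμ, h0, hn, -⟩ := hmir μ hm
    have := mfold_mem h0 hn (hx μ).1 (by rw [← hNμ]; exact (hx μ).2)
    constructor
    · omega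
    · rw [hNμ]; omega
  · rw [if_neg hm]; exact hx μ

/-- **THE FOLD** onto the closed mirror box, as a map of the fundamental box. [cite: Balaban1983RegularityDecay, (2.42) p.584, dictionary] -/
def tfold (hmir : ∀ μ, mir μ = true → (N μ : ℤ) = 2 * n μ ∧ 0 ≤ h μ ∧ h μ < n μ ∧ 2 ≤ n μ) (x : ↥(boxDom N)) : ↥(boxDom N) :=
  ⟨tfoldFun mir n h x.1, tfoldFun_mem hmir x.2⟩

/-- the coordinates of a folded site. [cite: Balaban1983RegularityDecay, (2.42) p.584, dictionary] -/
theorem tfold_apply_val (hmir : ∀ μ, mir μ = true → (N μ : ℤ) = 2 * n μ ∧ 0 ≤ h μ ∧ h μ < n μ ∧ 2 ≤ n μ) (x : ↥(boxDom N)) (μ : Fin (d + 1)) :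
    (tfold hmir x).1 μ = if mir μ = true then mfold (n μ) (h μ) (x.1 μ) else x.1 μ := rfl

/-- the fold lands in the closed mirror box. [cite: Balaban1983RegularityDecay, (2.42) p.584, bookkeeping] -/
theorem tfold_mem_closed (hmir : ∀ μ, mir μ = true → (N μ : ℤ) = 2 * n μ ∧ 0 ≤ h μ ∧ h μ < n μ ∧ 2 ≤ n μ) (x : ↥(boxDom N)) :
    tfold hmir x ∈ mirBoxClosed N mir n h := by
  rw [mirBoxClosed, Finset.mem_filter]
  refine ⟨Finset.mem_univ _, fun μ hm => ?_⟩
  rw [tfold_apply_val, if_pos hm]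
  obtain ⟨hNμ, h0, hn, -⟩ := hmir μ hm
  have hx := (mem_boxDom.1 x.2) μ
  exact mfold_mem h0 hn hx.1 (by rw [← hNμ]; exact hx.2)

/-- the fold is the identity on the closed mirror box. [cite: Balaban1983RegularityDecay, (2.42) p.584, bookkeeping] -/
theorem tfold_of_mem_closed (hmir : ∀ μ, mir μ = true → (N μ : ℤ) = 2 * n μ ∧ 0 ≤ h μ ∧ h μ < n μ ∧ 2 ≤ n μ)
    {x : ↥(boxDom N)} (hx : x ∈ mirBoxClosed N mir n h) : tfold hmir x = x := by
  rw [mirBoxClosed, Finset.mem_filter] at hx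
  refine Subtype.ext (funext fun μ => ?_)
  rw [tfold_apply_val]
  by_cases hm : mir μ = true
  · rw [if_pos hm]; exact mfold_of_mem (hx.2 μ hm).1 (hx.2 μ hm).2
  · rw [if_neg hm]

/-- ★ the fold is INVARIANT under the admissible face reflections (every site folds to the representative of its orbit). [cite: Balaban1983RegularityDecay, (2.42) p.584] -/
theorem tfold_trefl (hmir : ∀ μ, mir μ = true → (N μ : ℤ) = 2 * n μ ∧ 0 ≤ h μ ∧ h μ < n μ ∧ 2 ≤ n μ)
    (ε : Fin (d + 1) → Bool) (x : ↥(boxDom N)) : tfold hmir (trefl hmir ε x) = tfold hmir x := by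
  refine Subtype.ext (funext fun μ => ?_)
  rw [tfold_apply_val, tfold_apply_val, trefl_apply_val]
  by_cases hm : mir μ = true
  · rw [if_pos hm, if_pos hm]
    obtain ⟨hNμ, h0, hn, -⟩ := hmir μ hm
    have hx := (mem_boxDom.1 x.2) μ
    cases hε : ε μ
    · simp
    · simp only [hm, Bool.and_self, if_true]
      exact mfold_mref h0 hn hx.1 (by rw [← hNμ]; exact hx.2)
  · have hm' : mir μ = false := by simpa using hm
    simp [hm']

/-- ★ **THE FACE REFLECTIONS ARE ISOMETRIES of the torus sup-distance.** [cite: Balaban1984PropagatorsII, (2.2) p.224 (torus distance); Balaban1983RegularityDecay, (2.42) p.584] -/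
theorem torusSupNorm_trefl_sub (hmir : ∀ μ, mir μ = true → (N μ : ℤ) = 2 * n μ ∧ 0 ≤ h μ ∧ h μ < n μ ∧ 2 ≤ n μ)
    (ε : Fin (d + 1) → Bool) (x y : ↥(boxDom N)) :
    torusSupNorm N ((trefl hmir ε x).1 - (trefl hmir ε y).1) = torusSupNorm N (x.1 - y.1) := by
  unfold torusSupNorm
  congr 1
  funext μ
  rw [Pi.sub_apply, Pi.sub_apply, trefl_apply_val, trefl_apply_val]
  by_cases hb : (ε μ && mir μ) = true
  · rw [if_pos hb, if_pos hb]
    have hm : mir μ = true := by rw [Bool.and_eq_true] at hb; exact hb.2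
    obtain ⟨hNμ, h0, hn, -⟩ := hmir μ hm
    have hx := (mem_boxDom.1 x.2) μ
    have hy := (mem_boxDom.1 y.2) μ
    have hxN : x.1 μ < 2 * n μ := by rw [← hNμ]; exact hx.2
    have hyN : y.1 μ < 2 * n μ := by rw [← hNμ]; exact hy.2
    have hmx := mref_mem h0 hn hx.1 hxN
    have hmy := mref_mem h0 hn hy.1 hyN
    rw [circAbs_sub_eq_cdist hNμ hmx.1 hmx.2 hmy.1 hmy.2, circAbs_sub_eq_cdist hNμ hx.1 hxN hy.1 hyN, cdist_mref h0 hn hx.1 hxN hy.1 hyN]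
  · rw [if_neg hb, if_neg hb]

/-- ★ **THE FOLD IS 1-LIPSCHITZ for the torus sup-distance** (folding a path at the mirrors never lengthens it — the input of the distance monotonicity
`d(y, σy′) ≥ d(y, y′)` of the images bound). [cite: Balaban1984PropagatorsII, (2.2) p.224, (2.46) p.231; Balaban1983RegularityDecay, (2.42) p.584] -/
theorem torusSupNorm_tfold_sub_le (hmir : ∀ μ, mir μ = true → (N μ : ℤ) = 2 * n μ ∧ 0 ≤ h μ ∧ h μ < n μ ∧ 2 ≤ n μ)
    (x y : ↥(boxDom N)) :
    torusSupNorm N ((tfold hmir x).1 - (tfold hmir y).1) ≤ torusSupNorm N (x.1 - y.1) := by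
  unfold torusSupNorm
  refine Finset.sup'_le _ _ fun μ _ => le_trans ?_ (Finset.le_sup' (fun i => ((circAbs (N i) ((x.1 - y.1) i) : ℤ) : ℝ)) (Finset.mem_univ μ))
  rw [Pi.sub_apply, Pi.sub_apply, tfold_apply_val, tfold_apply_val]
  by_cases hm : mir μ = true
  · rw [if_pos hm, if_pos hm]
    obtain ⟨hNμ, h0, hn, h2⟩ := hmir μ hm
    have hx := (mem_boxDom.1 x.2) μ
    have hy := (mem_boxDom.1 y.2) μ
    have hxN : x.1 μ < 2 * n μ := by rw [← hNμ]; exact hx.2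
    have hyN : y.1 μ < 2 * n μ := by rw [← hNμ]; exact hy.2
    have hmx := mfold_mem h0 hn hx.1 hxN
    have hmy := mfold_mem h0 hn hy.1 hyN
    rw [circAbs_sub_eq_cdist hNμ (by omega) (by omega) (by omega) (by omega), circAbs_sub_eq_cdist hNμ hx.1 hxN hy.1 hyN]
    exact_mod_cast cdist_mfold_le h0 h2 hn hx.1 hxN hy.1 hyN
  · rw [if_neg hm, if_neg hm]

/-- ★ **GRID COMPATIBILITY OF THE FACE REFLECTIONS**: for a block side `S` such that in every mirrored direction the mirror is at an `S`-block centre and `S ∣ n_μ`,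
sites of one `S`-block reflect into one `S`-block. [cite: Balaban1984PropagatorsII, (2.1) p.224 («a sum of big blocks»); Balaban1983RegularityDecay, (2.42) p.584] -/
theorem blk_trefl_eq_of_blk_eq (hmir : ∀ μ, mir μ = true → (N μ : ℤ) = 2 * n μ ∧ 0 ≤ h μ ∧ h μ < n μ ∧ 2 ≤ n μ)
    {S : ℕ} (hS : 0 < S)
    (hgrid : ∀ μ, mir μ = true → ∃ c q₀ nS : ℤ, (S : ℤ) = 2 * c + 1 ∧ h μ = q₀ * S + c ∧ n μ = nS * S ∧ 1 ≤ nS)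
    (ε : Fin (d + 1) → Bool) {x y : ↥(boxDom N)} (he : blk S x.1 = blk S y.1) :
    blk S (trefl hmir ε x).1 = blk S (trefl hmir ε y).1 := by
  funext μ
  have heμ : x.1 μ / (S : ℤ) = y.1 μ / (S : ℤ) := congrFun he μ
  show (trefl hmir ε x).1 μ / (S : ℤ) = (trefl hmir ε y).1 μ / (S : ℤ)
  rw [trefl_apply_val, trefl_apply_val]
  by_cases hb : (ε μ && mir μ) = true
  · rw [if_pos hb, if_pos hb]
    have hm : mir μ = true := by rw [Bool.and_eq_true] at hb; exact hb.2
    obtain ⟨c, q₀, nS, hSc, hh, hnS, -⟩ := hgrid μ hm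
    exact ediv_mref_eq_of_ediv_eq (by exact_mod_cast hS) hSc hh hnS heμ
  · rw [if_neg hb, if_neg hb]; exact heμ

/-- ★ **GRID COMPATIBILITY OF THE FOLD** (same data): sites of one `S`-block fold into one `S`-block. [cite: Balaban1984PropagatorsII, (2.1) p.224; Balaban1983RegularityDecay, (2.42) p.584] -/
theorem blk_tfold_eq_of_blk_eq (hmir : ∀ μ, mir μ = true → (N μ : ℤ) = 2 * n μ ∧ 0 ≤ h μ ∧ h μ < n μ ∧ 2 ≤ n μ)
    {S : ℕ} (hS : 0 < S)
    (hgrid : ∀ μ, mir μ = true → ∃ c q₀ nS : ℤ, (S : ℤ) = 2 * c + 1 ∧ h μ = q₀ * S + c ∧ n μ = nS * S ∧ 1 ≤ nS)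
    {x y : ↥(boxDom N)} (he : blk S x.1 = blk S y.1) :
    blk S (tfold hmir x).1 = blk S (tfold hmir y).1 := by
  funext μ
  have heμ : x.1 μ / (S : ℤ) = y.1 μ / (S : ℤ) := congrFun he μ
  show (tfold hmir x).1 μ / (S : ℤ) = (tfold hmir y).1 μ / (S : ℤ)
  rw [tfold_apply_val, tfold_apply_val]
  by_cases hm : mir μ = true
  · rw [if_pos hm, if_pos hm]
    obtain ⟨c, q₀, nS, hSc, hh, hnS, hnS1⟩ := hgrid μ hm
    exact ediv_mfold_eq_of_ediv_eq (by exact_mod_cast hS) hSc hh hnS hnS1 heμ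
  · rw [if_neg hm, if_neg hm]; exact heμ


/-! ### Reflections versus torus translations; invariance of the periodic Laplacian -/

/-- the action of a face reflection on translation vectors: negate the acting coordinates. [cite: Balaban1983RegularityDecay, (2.42) p.584, dictionary] -/
def vrefl (mir ε : Fin (d + 1) → Bool) (v : Fin (d + 1) → ℤ) : Fin (d + 1) → ℤ := fun μ => if (ε μ && mir μ) = true then -v μ else v μ

/-- `vrefl` is an involution. [cite: Balaban1983RegularityDecay, (2.42) p.584, bookkeeping] -/
theorem vrefl_vrefl (mir ε : Fin (d + 1) → Bool) (v : Fin (d + 1) → ℤ) : vrefl mir ε (vrefl mir ε v) = v := by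
  funext μ; unfold vrefl; split_ifs <;> ring

/-- `vrefl (−v) = −vrefl v`. [cite: Balaban1983RegularityDecay, (2.42) p.584, bookkeeping] -/
theorem vrefl_neg (mir ε : Fin (d + 1) → Bool) (v : Fin (d + 1) → ℤ) : vrefl mir ε (-v) = -vrefl mir ε v := by
  funext μ; unfold vrefl; simp only [Pi.neg_apply]; split_ifs <;> ring

/-- ★ **REFLECTIONS CONJUGATE TRANSLATIONS**: `σ_ε ∘ τ_v = τ_{v^ε} ∘ σ_ε` with `v^ε` the vector `v` negated in the acting coordinates (a reflection through `h` is
`t ↦ 2h − t` on `ℤ/N`, which turns `t ↦ t + w` into `t ↦ t − w`). [cite: Balaban1983RegularityDecay, (2.42) p.584; (1.3) p.572 («periodic conditions»)] -/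
theorem trefl_tshift (hmir : ∀ μ, mir μ = true → (N μ : ℤ) = 2 * n μ ∧ 0 ≤ h μ ∧ h μ < n μ ∧ 2 ≤ n μ) (ε : Fin (d + 1) → Bool)
    (v : Fin (d + 1) → ℤ) (x : ↥(boxDom N)) :
    trefl hmir ε (tshift N v x) = tshift N (vrefl mir ε v) (trefl hmir ε x) := by
  refine Subtype.ext (funext fun μ => ?_)
  rw [trefl_apply_val, tshift_val, tshift_val]
  unfold twrap vrefl
  simp only [Pi.add_apply, trefl_apply_val]
  have hxμ := (mem_boxDom.1 x.2) μ
  have hN1 : (1 : ℤ) ≤ N μ := by exact_mod_cast one_le_of_mem x.2 μ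
  by_cases hb : (ε μ && mir μ) = true
  · rw [if_pos hb, if_pos hb, if_pos hb]
    have hm : mir μ = true := by rw [Bool.and_eq_true] at hb; exact hb.2
    obtain ⟨hNμ, h0, hn, -⟩ := hmir μ hm
    have hr0 : 0 ≤ (x.1 μ + v μ) % (N μ : ℤ) := Int.emod_nonneg _ (by omega)
    have hr1 : (x.1 μ + v μ) % (N μ : ℤ) < N μ := Int.emod_lt_of_pos _ (by omega)
    rw [mref_eq_emod h0 hn hr0 (by rw [← hNμ]; exact hr1), mref_eq_emod h0 hn hxμ.1 (by rw [← hNμ]; exact hxμ.2), ← hNμ,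
      Int.sub_emod_emod, Int.emod_add_emod]
    congr 1; ring
  · rw [if_neg hb, if_neg hb, if_neg hb]

/-- ★ **THE PERIODIC LAPLACIAN IS INVARIANT UNDER THE FACE REFLECTIONS**: `(−Δ^{per})(σx, σy) = (−Δ^{per})(x, y)` (the reflections are isometries of the torus
exchanging the forward and backward neighbours in the acting directions). [cite: Balaban1983RegularityDecay, (2.42) p.584 («the propagator G_j with free boundary conditions» is reflection invariant); (1.3) p.572] -/
theorem perLapT_trefl (hmir : ∀ μ, mir μ = true → (N μ : ℤ) = 2 * n μ ∧ 0 ≤ h μ ∧ h μ < n μ ∧ 2 ≤ n μ) (ε : Fin (d + 1) → Bool)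
    (x y : ↥(boxDom N)) : perLapT N (trefl hmir ε x) (trefl hmir ε y) = perLapT N x y := by
  unfold perLapT shiftMat
  simp only [Matrix.sum_apply, Matrix.sub_apply, Matrix.smul_apply, Matrix.one_apply, smul_eq_mul]
  refine Finset.sum_congr rfl fun μ _ => ?_
  have hinj : ∀ a b : ↥(boxDom N), (trefl hmir ε a = trefl hmir ε b) ↔ a = b := fun a b => (trefl hmir ε).injective.eq_iff
  -- `σy = τ_{±e_μ}(σx) ⟺ y = τ_{(±e_μ)^ε} x`, and `{(e_μ)^ε, (−e_μ)^ε} = {e_μ, −e_μ}`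
  have key : ∀ w : Fin (d + 1) → ℤ, (trefl hmir ε y = tshift N w (trefl hmir ε x)) ↔ (y = tshift N (vrefl mir ε w) x) := by
    intro w
    have e1 : tshift N w (trefl hmir ε x) = trefl hmir ε (tshift N (vrefl mir ε w) x) := by
      rw [trefl_tshift, vrefl_vrefl]
    rw [e1, hinj]
  simp only [hinj, key, vrefl_neg]
  by_cases hb : (ε μ && mir μ) = true
  · have ev : vrefl mir ε (unitVec μ) = -unitVec μ := by
      funext ν; unfold vrefl unitVec
      by_cases hν : ν = μ
      · subst hν; rw [if_pos hb]; simp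
      · simp [Pi.single_eq_of_ne hν]
    simp only [ev, neg_neg]; ring
  · have ev : vrefl mir ε (unitVec μ) = unitVec μ := by
      funext ν; unfold vrefl unitVec
      by_cases hν : ν = μ
      · subst hν; rw [if_neg hb]
      · simp [Pi.single_eq_of_ne hν]
    simp only [ev]

/-- the torus distance from a site to its translate by `v` is at most `|v|_∞` (so torus-nearest neighbours are at distance `≤ 1`).
[cite: Balaban1983RegularityDecay, p.572 («periodic conditions»); Balaban1984PropagatorsII, (2.2) p.224, bookkeeping] -/
theorem torusSupNorm_tshift_self_sub_le (v : Fin (d + 1) → ℤ) (x : ↥(boxDom N)) :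
    torusSupNorm N ((tshift N v x).1 - x.1) ≤ supNorm v := by
  obtain ⟨w, hw⟩ := tshift_val_eq_translate N v x
  have e : (tshift N v x).1 - x.1 = translate N v w := by
    rw [hw]; funext i; simp only [Pi.sub_apply, translate_apply, Pi.add_apply]; ring
  rw [e, torusSupNorm_translate]
  exact torusSupNorm_le_supNorm (one_le_of_mem x.2) v

end Box

end

end Literature.MathematicalPhysics.QuantumFieldTheory.Balaban1983to89.B4Eq242TorusMirrors
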